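import Literature.IUT.HodgeArakelov.KummerPrimeStripsGaloisWitness
import Literature.IUT.HodgeArakelov.KummerStructuresProofs
import HarnessLib

/-!
# [IUTchII] Def 4.9 (i) / Rmk 1.11.1 (i)(b): «any `×`-Kummer structure on `C` is unique» — MODELS, positive and negative
# (FACT-LIST F-2062 `KummerTimesUnique`; abc-iut cell, layer L6, seat abc-iut-w4-d028 gen 3; PROOF-ONLY — no def / instance)

S. Mochizuki, *Inter-universal Teichmüller theory II*, kurims Dec-2020 manuscript, Def 4.9 (i) p. 154 («a `×`-Kummer
structure on `C` … a `Ẑ^×`-orbit of isomorphisms `κ^× : O^×(G) ⥲ O^×(A)` of ind-topological `G`-modules … any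
`×`-Kummer structure on `C` is unique [cf. Remark 1.11.1, (i), (b)]»), Rmk 1.11.1 (i)(b) p. 50.
[claim: Mochizuki2012, status: disputed] — nothing here asserts a disputed claim or takes a side on [IUTchIII] Cor 3.12.

The named statement `KummerTimesUnique X M` (abc-iut-L6-t2, `KummerStructures`; FACT-LIST F-2062, class «inside the cone:
prove or GAP», currently CONDITIONAL on abc-iut-L6-d1's `kummerTimesUnique_of_linearAut_mem_zhatUnits`, whose hypothesis is
print's kernel statement of Rmk 1.11.1 (i)(b): «every `G`-linear automorphism of `O^×(G)` lies in `Im(Ẑ^×)`») is examined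
at MODELS of the typed interface `GroupTheoreticUnits` — whose field `zhatUnits` RECORDS `Im(Ẑ^×) ⊆ Aut(O^×(G))` as data:

* §1 NEGATIVE, generic (`KummerTimesUnique.not_of_zhatUnits_eq_bot`): at ANY group-theoretic units with `Im(Ẑ^×) := 1`
  carrying one `×`-Kummer structure, `KummerTimesUnique` FAILS as soon as `O^×(G)` has an element `u` with `u⁻¹ ≠ u`
  (inversion is a non-trivial `G`-linear automorphism; abc-iut-L6-d1's converse `linearAut_mem_zhatUnits_of_kummerTimesUnique`).
  Hence (`not_tautological`, `not_tautological_trivialAction`) it is FALSE at the literal tautological units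
  `(O^×(A), Im(Ẑ^×) := 1)` of the landed witnesses of the Def 4.9 records (abc-iut-L6-d7 p406437, abc-iut-w5-d087
  p416833, abc-iut-w4-d028 p418814 / p424742: monoid `ℤ_p ∖ {0}` resp. `𝒪_k̄^× × q^ℕ`) as soon as one unit `u` has
  `u⁻¹ ≠ u` (e.g. `1 + p ∈ ℤ_p^×`, resp. a cube root of unity — §3).
* §2 POSITIVE at a GENUINE-GALOIS model (`NonarchTriMuDatum.exists_galois_commutant`): the genuine-Galois local datum of
  `KummerPrimeStripsGaloisWitness` (p424742: `‡G = Π_k ↷ 𝒪_k̄^× × q^ℕ` through `ε_k`, abc-iut-L4-t1's `ModelMLFGaloisData`)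
  re-equipped with `Im(Ẑ^×) := Z(Π_k)` = the COMMUTANT of the `Π_k`-action in `Aut(O^×(G))` — which CONTAINS print's
  `Ẑ^×` and, for the ind-topological module, EQUALS it exactly when Rmk 1.11.1 (i)(b) holds — satisfies the hypothesis of
  the conditional discharge TAUTOLOGICALLY, so `KummerTimesUnique X M` HOLDS for EVERY Frobenioid datum `M` over it, the
  `×`-Kummer structure of the datum is «the unique» one (its orbit = ALL equivariant isomorphisms, abc-iut-L6-d1's
  `kummerTimes_orbit_eq_univ`), and all Def 4.9 (iii) data stay jointly inhabited (defining equations in the statement).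
* §3 the dichotomy at ONE genuine Galois action (`not_kummerTimesUnique_galois_bot`, `…_dichotomy_mlfClosure`,
  `…_dichotomy_padic`): the SAME genuine datum with `Im(Ẑ^×) := 1` (p424742) violates `KummerTimesUnique` whenever
  `𝒪_k̄^×` has a unit of order `∉ {1, 2}` — always, for an MLF closure (a primitive cube root of unity,
  `MLFClosure.exists_unit_mul_self_ne_one`).

READING (for the FACT-LIST / hypotheses audit, no side taken): F-2062 is neither vacuous nor automatic at the typed
interface — its truth value at a model is decided by the recorded datum `Im(Ẑ^×)`, i.e. by Rmk 1.11.1 (i)(b) itself; the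
anabelian content (that the commutant of `G_k ↷ 𝒪_k̄^×` as an IND-TOPOLOGICAL module IS `Ẑ^×`, [AbsTopIII] Prop 3.3 (ii))
is not modelled by these abstract-group records and is not claimed.
-/

noncomputable section

namespace Literature.IUT.HodgeArakelov

open CategoryTheory
open Literature.AnabelianGeometry.AbsoluteAnabelian
universe u v w

/-! ### §1 `Im(Ẑ^×) := 1` + one unit of order `∉ {1,2}` ⇒ `×`-Kummer structures are NOT unique -/

namespace KummerTimesUnique

variable {G : Type u} [Group G]

/-- **IUTchII:Def4.9(i)** (kurims p.154) NEGATIVE MODEL CRITERION for the named statement «any `×`-Kummer structure on `C`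
is unique»: if the group-theoretic units record `Im(Ẑ^×) := 1`, one `×`-Kummer structure exists, and `O^×(G)` has an
element `u` with `u⁻¹ ≠ u`, then `KummerTimesUnique X M` is FALSE — inversion `u ↦ u⁻¹` is a `G`-linear automorphism of
the commutative group `O^×(G)` not in `Im(Ẑ^×) = 1`, contradicting abc-iut-L6-d1's converse
`linearAut_mem_zhatUnits_of_kummerTimesUnique` (Rmk 1.11.1 (i)(b) is NECESSARY). [cite: Mochizuki2012, Def 4.9 (i) p.154] -/
theorem not_of_zhatUnits_eq_bot (X : GroupTheoreticUnits.{u, v} G) (M : CoveringMonoid.{u, w} G)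
    (hX : X.zhatUnits = ⊥) (κ₁ : KummerTimes X M) (u : X.OxG) (hu : u⁻¹ ≠ u) : ¬ KummerTimesUnique X M := by
  intro huniq
  -- inversion, a `G`-linear automorphism of the commutative group `O^×(G)`
  let ψ : MulAut X.OxG := MulEquiv.inv X.OxG
  have hψ : ∀ g : G, ψ * X.act g = X.act g * ψ := fun g => by
    apply MulEquiv.ext
    intro x
    show (X.act g x)⁻¹ = X.act g x⁻¹
    exact (map_inv (X.act g) x).symm
  have hmem := linearAut_mem_zhatUnits_of_kummerTimesUnique X M κ₁ huniq ψ hψ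
  rw [hX, Subgroup.mem_bot] at hmem
  have h := MulEquiv.congr_fun hmem u
  exact hu h

/-- **IUTchII:Def4.9(i)** (kurims p.154) … in particular at the LITERAL tautological group-theoretic units
`(O^×(G) := O^×(A), Im(Ẑ^×) := 1)` of abc-iut-L6-d7's `nonempty_kummerTimes_tautological` — the units datum of EVERY landed
witness of the Def 4.9 records (p406437, p416833, p418814, p424742) — `KummerTimesUnique` is FALSE for every covering monoid
whose unit group has an element `u` with `u⁻¹ ≠ u`, and every family of open subgroups. [cite: Mochizuki2012, Def 4.9 (i) p.154] -/
theorem not_tautological (M : CoveringMonoid.{u, v} G) (opens : Set (Subgroup G)) (u : M.Oˣ) (hu : u⁻¹ ≠ u) :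
    ¬ KummerTimesUnique
      ({ OxG := M.Oˣ, act := M.unitsAct, openSubgroups := opens, zhatUnits := ⊥,
         zhatUnits_comm := fun γ hγ g => by rw [Subgroup.mem_bot.mp hγ, one_mul, mul_one] } :
        GroupTheoreticUnits.{u, v} G) M := by
  obtain ⟨κ₁⟩ := nonempty_kummerTimes_tautological G M opens
  exact not_of_zhatUnits_eq_bot _ M rfl κ₁ u hu

/-- **IUTchII:Def4.9(i)** (kurims p.154) … in particular for the TRIVIAL `G`-action on any commutative monoid `O` (the shape
of abc-iut-L6-d7's `nonempty_nonarchTriMuDatum` p406437 and abc-iut-w5-d087's strip witness p416833: `O = ℤ_p ∖ {0}`,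
`G ↷ O` trivial, tautological units, `Im(Ẑ^×) := 1`): `KummerTimesUnique` is FALSE as soon as `O^×` has a unit `u` with
`u⁻¹ ≠ u`. [cite: Mochizuki2012, Def 4.9 (i) p.154] -/
theorem not_tautological_trivialAction (O : Type v) [CommMonoid O] (u : Oˣ) (hu : u⁻¹ ≠ u) (G : Type u) [Group G]
    (opens : Set (Subgroup G)) :
    ¬ KummerTimesUnique
      ({ OxG := (⟨CommMonCat.of O, 1⟩ : CoveringMonoid.{u, v} G).Oˣ,
         act := (⟨CommMonCat.of O, 1⟩ : CoveringMonoid.{u, v} G).unitsAct,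
         openSubgroups := opens, zhatUnits := ⊥,
         zhatUnits_comm := fun γ hγ g => by rw [Subgroup.mem_bot.mp hγ, one_mul, mul_one] } :
        GroupTheoreticUnits.{u, v} G) ⟨CommMonCat.of O, 1⟩ :=
  not_tautological ⟨CommMonCat.of O, 1⟩ opens u hu

end KummerTimesUnique

/-! ### §2 The genuine-Galois datum with `Im(Ẑ^×) := Z(Π_k)`: `×`-Kummer structures ARE unique there -/

namespace NonarchTriMuDatum

variable {k : Type} [Field k] [ValuativeRel k] {K : Type} [Field K] [Algebra k K]
  (D : ModelMLFGaloisData.{0} k K)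

/-- **IUTchII:Def4.9(i)** (kurims p.154) + **(iii)** (p.155) GENUINE-GALOIS MODEL WHERE «any `×`-Kummer structure is
unique» HOLDS: for every `l`, every nonarchimedean place type and every [AbsTopIII] Def 3.1 model data `D`
(`ε_k : Π_k ↠ Gal(k̄/k)`), there are group-theoretic units `X` — `O^×(G) ≅ 𝒪_k̄^× ⊆ k̄` via the injection `ι` with
`ι(g · u) = ε_k(g) · ι(u)`, open subgroups = the open subgroups of `Π_k`, and `Im(Ẑ^×) := Z(Π_k)`, the COMMUTANT of the
`Π_k`-action in `Aut(O^×(G))` (⊇ print's `Ẑ^×`; `=` it iff Rmk 1.11.1 (i)(b) for the ind-topological module) — and a local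
datum `T = ‡F^{⊢▶×μ}_w` over `X` with `O^▷ = 𝒪_k̄^× × q^ℕ`, `Π_k` acting through `ε_k` on the first factor, splitting
`q^ℕ` (equations through `e`), such that `KummerTimesUnique X M` holds for EVERY Frobenioid datum `M` over `X`
(abc-iut-L6-d1's `kummerTimesUnique_of_linearAut_mem_zhatUnits`, hypothesis tautological here) and the `×`-Kummer
structure of `T` is «the unique» one: its orbit is the set of ALL `Π_k`-equivariant isomorphisms `O^×(G) ⥲ O^×(‡A)`.
[cite: Mochizuki2012, Def 4.9 (i) p.154] -/
theorem exists_galois_commutant (l : ℕ) (kd : PlaceKind) :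
    ∃ (X : GroupTheoreticUnits.{0, 0} D.Pi) (T : NonarchTriMuDatum.{0, 0, 0} l kd D.Pi X)
      (e : (T.O : Type) ≃* ↥(unitSubmonoid k K) × Multiplicative ℕ) (ι : X.OxG →* K),
      X.openSubgroups = {H : Subgroup D.Pi | IsOpen (H : Set D.Pi)} ∧
      X.zhatUnits = Subgroup.centralizer (Set.range X.act) ∧
      Function.Injective ι ∧ Set.range ι = ↑(unitSubmonoid k K) ∧
      (∀ (g : D.Pi) (u : X.OxG), ι (X.act g u) = D.aug g • ι u) ∧
      (∀ (g : D.Pi) (x : T.O), e (T.act g x) = (g • (e x).1, (e x).2)) ∧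
      (∀ x : T.O, x ∈ T.splitting ↔ (e x).1 = 1) ∧
      (∀ M : CoveringMonoid.{0, 0} D.Pi, KummerTimesUnique X M) ∧
      T.kummerTimes.orbit = Set.univ := by
  classical
  obtain ⟨X₀, T₀, e, ι₀, -, -, -, -, -, hact, hspl⟩ := NonarchTriMuDatum.exists_galois D l kd
  -- every element of `𝒪_k̄^×` is a unit of that monoid
  have hunitU : ∀ u : ↥(unitSubmonoid k K), IsUnit u := by
    intro u
    obtain ⟨hx, y, hy, hxy⟩ := u.2
    refine ⟨⟨u, ⟨y, hy, u, hx, by rw [mul_comm]; exact hxy⟩, Subtype.ext hxy,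
      Subtype.ext (by rw [Submonoid.coe_mul, mul_comm]; exact hxy)⟩, rfl⟩
  -- units of the product have trivial `q`-component
  have hsnd : ∀ w : (↥(unitSubmonoid k K) × Multiplicative ℕ)ˣ, (w : ↥(unitSubmonoid k K) × Multiplicative ℕ).2 = 1 := by
    intro w
    have h := congrArg Prod.snd w.mul_inv
    rw [Prod.snd_mul, Prod.snd_one] at h
    have h' := congrArg Multiplicative.toAdd h
    rw [toAdd_mul, toAdd_one] at h'
    apply Multiplicative.toAdd.injective
    rw [toAdd_one]
    omega
  -- the same covering monoid, re-equipped: `Im(Ẑ^×) := Z(Π_k)`, the commutant of the action on `O^×`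
  let M : CoveringMonoid.{0, 0} D.Pi := T₀.covering
  let opens : Set (Subgroup D.Pi) := {H : Subgroup D.Pi | IsOpen (H : Set D.Pi)}
  let X : GroupTheoreticUnits.{0, 0} D.Pi :=
    { OxG := M.Oˣ, act := M.unitsAct, openSubgroups := opens,
      zhatUnits := Subgroup.centralizer (Set.range M.unitsAct),
      zhatUnits_comm := fun γ hγ g => (Subgroup.mem_centralizer_iff.mp hγ (M.unitsAct g) ⟨g, rfl⟩).symm }
  have hker : ∀ ψ : MulAut X.OxG, (∀ g : D.Pi, ψ * X.act g = X.act g * ψ) → ψ ∈ X.zhatUnits := by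
    intro ψ hψ
    refine Subgroup.mem_centralizer_iff.mpr ?_
    rintro _ ⟨g, rfl⟩
    exact (hψ g).symm
  -- the identity is an equivariant isomorphism `O^×(G) = O^×(‡A) ⥲ O^×(‡A)`; its orbit under the commutant is everything
  let κ₀ : EquivariantIso X.act M.unitsAct := ⟨MulEquiv.refl _, fun _ _ => rfl⟩
  let κ : KummerTimes X M :=
    { orbit := Set.univ
      isOrbit := ⟨κ₀, Set.mem_univ _, fun κ' => ⟨fun _ => ⟨(κ'.toMulEquiv : MulAut M.Oˣ),
        Subgroup.mem_centralizer_iff.mpr (by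
          rintro _ ⟨g, rfl⟩
          apply MulEquiv.ext
          intro x
          show M.unitsAct g (κ'.toMulEquiv x) = κ'.toMulEquiv (M.unitsAct g x)
          exact (κ'.map_act g x).symm),
        MulEquiv.ext fun _ => rfl⟩, fun _ => Set.mem_univ _⟩⟩ }
  have h1 : MulEquiv.trans (1 : MulAut (UnitsModTorsion M.O)) (MulEquiv.refl _) = MulEquiv.refl _ :=
    MulEquiv.ext fun _ => rfl
  let κμ : KummerTimesMu X M :=
    { orbit := {κ' | ∃ γ ∈ isometryGroup M.unitsAct opens,
        κ'.toMulEquiv = γ.trans (MulEquiv.refl (UnitsModTorsion M.O))}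
      isOrbit := ⟨⟨MulEquiv.refl _, fun _ _ => rfl⟩, ⟨1, Subgroup.one_mem _, h1.symm⟩, fun _ => Iff.rfl⟩ }
  let T : NonarchTriMuDatum.{0, 0, 0} l kd D.Pi X := ⟨T₀.O, T₀.act, T₀.splitting, T₀.presents, κ, κμ⟩
  -- `O^×(G) ↪ k̄`: units of `𝒪_k̄^× × q^ℕ`, read through `e`, then the first factor
  let ι : X.OxG →* K :=
    (((unitSubmonoid k K).subtype.comp (MonoidHom.fst _ (Multiplicative ℕ))).comp e.toMonoidHom).comp
      (Units.coeHom T₀.O)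
  have ι_apply : ∀ u : X.OxG, ι u = ((e ((u : M.Oˣ) : T₀.O)).1 : K) := fun _ => rfl
  refine ⟨X, T, e, ι, rfl, rfl, ?_, ?_, ?_, hact, hspl,
    fun M' => kummerTimesUnique_of_linearAut_mem_zhatUnits X M' hker, rfl⟩
  · -- `ι` is injective
    intro a b h
    rw [ι_apply, ι_apply] at h
    have h2a := hsnd (Units.map e.toMonoidHom a)
    have h2b := hsnd (Units.map e.toMonoidHom b)
    have hab : e ((a : M.Oˣ) : T₀.O) = e ((b : M.Oˣ) : T₀.O) :=
      Prod.ext (Subtype.ext h) (h2a.trans h2b.symm)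
    exact Units.ext (e.injective hab)
  · -- the range of `ι` is `𝒪_k̄^×`
    ext x
    constructor
    · rintro ⟨a, rfl⟩
      rw [ι_apply]
      exact Subtype.coe_prop _
    · intro hx
      obtain ⟨c, hc⟩ := hunitU ⟨x, hx⟩
      refine ⟨Units.map e.symm.toMonoidHom (Units.map (MonoidHom.inl _ (Multiplicative ℕ)) c), ?_⟩
      rw [ι_apply]
      show ((e (e.symm ((c : ↥(unitSubmonoid k K)), (1 : Multiplicative ℕ)))).1 : K) = x
      rw [MulEquiv.apply_symm_apply, hc]
  · -- `ι` is `Π_k`-equivariant through `ε_k`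
    intro g a
    rw [ι_apply, ι_apply]
    show ((e (T₀.act g ((a : M.Oˣ) : T₀.O))).1 : K) = D.aug g • ((e ((a : M.Oˣ) : T₀.O)).1 : K)
    rw [hact]
    rfl

/-! ### §3 … while the SAME genuine Galois action with `Im(Ẑ^×) := 1` violates it -/

/-- **IUTchII:Def4.9(i)** (kurims p.154) DICHOTOMY AT THE GENUINE GALOIS ACTION: the genuine-Galois local datum of p424742
(`‡G = Π_k ↷ 𝒪_k̄^× × q^ℕ` through `ε_k`, group-theoretic units `≅ 𝒪_k̄^×` equivariantly, but `Im(Ẑ^×) := 1`) VIOLATES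
«any `×`-Kummer structure is unique» as soon as `𝒪_k̄^×` contains a unit `x` with `x · x ≠ 1` (inversion is then a
non-trivial `Π_k`-linear automorphism outside `Im(Ẑ^×) = 1`). [cite: Mochizuki2012, Def 4.9 (i) p.154] -/
theorem not_kummerTimesUnique_galois_bot (l : ℕ) (kd : PlaceKind) (hx : ∃ x ∈ unitSubmonoid k K, x * x ≠ 1) :
    ∃ (X : GroupTheoreticUnits.{0, 0} D.Pi) (T : NonarchTriMuDatum.{0, 0, 0} l kd D.Pi X) (ι : X.OxG →* K),
      X.zhatUnits = ⊥ ∧ Function.Injective ι ∧ Set.range ι = ↑(unitSubmonoid k K) ∧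
      (∀ (g : D.Pi) (u : X.OxG), ι (X.act g u) = D.aug g • ι u) ∧
      ¬ KummerTimesUnique X T.covering := by
  obtain ⟨X, T, -, ι, -, hz, hinj, hran, hιact, -, -⟩ := NonarchTriMuDatum.exists_galois D l kd
  obtain ⟨x, hxU, hxx⟩ := hx
  obtain ⟨u, hu⟩ : x ∈ Set.range ι := by rw [hran]; exact hxU
  refine ⟨X, T, ι, hz, hinj, hran, hιact,
    KummerTimesUnique.not_of_zhatUnits_eq_bot X T.covering hz T.kummerTimes u fun h => hxx ?_⟩
  have h' : ι u⁻¹ * ι u = 1 := by rw [← map_mul, inv_mul_cancel, map_one]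
  rwa [h, hu] at h'

/-- `𝒪_k̄^×` of an MLF closure has a unit of order `3` (a primitive cube root of unity of the algebraically closed,
characteristic-zero field `k̄`, integral as a root of `X² + X + 1`), in particular a unit `x` with `x · x ≠ 1` — an
elementary property of the object `𝒪_k̄^×` of [AbsTopIII] Def 3.1 (i) (abc-iut-L4-t1's `unitSubmonoid`).
[cite: MochizukiAbsTopIII2015, Definition 3.1 (i) p.66] -/
theorem _root_.Literature.AnabelianGeometry.AbsoluteAnabelian.MLFClosure.exists_unit_mul_self_ne_one
    (C : MLFClosure.{0}) : ∃ x ∈ unitSubmonoid C.k C.K, x * x ≠ 1 := by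
  haveI : IsAlgClosed C.K := C.instClosure.isAlgClosed
  haveI : CharZero C.K := charZero_of_injective_algebraMap (algebraMap C.k C.K).injective
  -- a root `ζ` of `X² + X + 1`
  obtain ⟨ζ, hζ⟩ := IsAlgClosed.exists_root
    (Polynomial.C 1 * Polynomial.X ^ 2 + Polynomial.C 1 * Polynomial.X + Polynomial.C 1 : Polynomial C.K)
    (by rw [Polynomial.degree_quadratic one_ne_zero]; exact two_ne_zero)
  have hζ' : ζ ^ 2 + ζ + 1 = 0 := by
    have := hζ
    simp only [Polynomial.IsRoot.def, Polynomial.eval_add, Polynomial.eval_mul, Polynomial.eval_C,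
      Polynomial.eval_pow, Polynomial.eval_X, one_mul] at this
    exact this
  have hζ3 : ζ * (ζ * ζ) = 1 := by linear_combination (ζ - 1) * hζ'
  -- `ζ` is integral over `𝒪_k`: a root of the monic `X² + (X + 1)`
  have hint : ζ ∈ integersClosure C.k C.K := by
    show IsIntegral _ ζ
    refine ⟨Polynomial.X ^ 2 + (Polynomial.X + Polynomial.C 1), ?_, ?_⟩
    · exact Polynomial.monic_X_pow_add (by rw [Polynomial.degree_X_add_C]; exact Nat.one_lt_ofNat)
    · rw [Polynomial.eval₂_add, Polynomial.eval₂_add, Polynomial.eval₂_X_pow, Polynomial.eval₂_X,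
        Polynomial.eval₂_C, map_one]
      rw [← hζ']
      ring
  refine ⟨ζ, ⟨hint, ζ * ζ, Subalgebra.mul_mem _ hint hint, hζ3⟩, fun hsq => ?_⟩
  have h2 : ζ = -2 := by linear_combination hζ' - hsq
  subst h2
  have h3 : (3 : C.K) = 0 := by linear_combination hsq
  exact three_ne_zero h3

/-- **IUTchII:Def4.9(i)** (kurims p.154) CLOSED DICHOTOMY over any MLF closure `C` (e.g. `MLFClosure.padic p`: `k = ℚ_p`,
`k̄ = ℚ̄_p`) with `‡G := Gal(k̄/k)` itself (`ModelMLFGaloisData.galois`): the genuine-Galois Def 4.9 (iii) datum exists BOTH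
with `Im(Ẑ^×) := Z(G_k)` — where `KummerTimesUnique` holds for every Frobenioid datum — AND with `Im(Ẑ^×) := 1` — where it
fails (cube root of unity). The recorded datum `Im(Ẑ^×)`, i.e. Rmk 1.11.1 (i)(b), decides F-2062 at a model.
[cite: Mochizuki2012, Def 4.9 (i) p.154] -/
theorem kummerTimesUnique_dichotomy_mlfClosure (C : MLFClosure.{0}) (l : ℕ) (kd : PlaceKind) :
    (∃ (X : GroupTheoreticUnits.{0, 0} (ModelMLFGaloisData.galois C.k C.K).Pi)
        (_ : NonarchTriMuDatum.{0, 0, 0} l kd (ModelMLFGaloisData.galois C.k C.K).Pi X),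
        X.zhatUnits = Subgroup.centralizer (Set.range X.act) ∧
        ∀ M : CoveringMonoid.{0, 0} (ModelMLFGaloisData.galois C.k C.K).Pi, KummerTimesUnique X M) ∧
    (∃ (X : GroupTheoreticUnits.{0, 0} (ModelMLFGaloisData.galois C.k C.K).Pi)
        (T : NonarchTriMuDatum.{0, 0, 0} l kd (ModelMLFGaloisData.galois C.k C.K).Pi X),
        X.zhatUnits = ⊥ ∧ ¬ KummerTimesUnique X T.covering) := by
  constructor
  · obtain ⟨X, T, -, -, -, hz, -, -, -, -, -, huniq, -⟩ :=
      exists_galois_commutant (ModelMLFGaloisData.galois C.k C.K) l kd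
    exact ⟨X, T, hz, huniq⟩
  · obtain ⟨X, T, -, hz, -, -, -, hnot⟩ := not_kummerTimesUnique_galois_bot (ModelMLFGaloisData.galois C.k C.K) l kd
      (MLFClosure.exists_unit_mul_self_ne_one C)
    exact ⟨X, T, hz, hnot⟩

/-- **IUTchII:Def4.9(i)** (kurims p.154) CLOSED INSTANCE (no free parameters, for the census): the dichotomy over
`k = ℚ_p`, `k̄ = ℚ̄_p` (`MLFClosure.padic p`), `‡G := Gal(ℚ̄_p/ℚ_p)`, at every `l` and every nonarchimedean place type.
[cite: Mochizuki2012, Def 4.9 (i) p.154] -/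
theorem kummerTimesUnique_dichotomy_padic (p : ℕ) [Fact p.Prime] (l : ℕ) (kd : PlaceKind) :
    (∃ (X : GroupTheoreticUnits.{0, 0}
          (ModelMLFGaloisData.galois (MLFClosure.padic p).k (MLFClosure.padic p).K).Pi)
        (_ : NonarchTriMuDatum.{0, 0, 0} l kd
          (ModelMLFGaloisData.galois (MLFClosure.padic p).k (MLFClosure.padic p).K).Pi X),
        X.zhatUnits = Subgroup.centralizer (Set.range X.act) ∧
        ∀ M : CoveringMonoid.{0, 0} (ModelMLFGaloisData.galois (MLFClosure.padic p).k (MLFClosure.padic p).K).Pi,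
          KummerTimesUnique X M) ∧
    (∃ (X : GroupTheoreticUnits.{0, 0}
          (ModelMLFGaloisData.galois (MLFClosure.padic p).k (MLFClosure.padic p).K).Pi)
        (T : NonarchTriMuDatum.{0, 0, 0} l kd
          (ModelMLFGaloisData.galois (MLFClosure.padic p).k (MLFClosure.padic p).K).Pi X),
        X.zhatUnits = ⊥ ∧ ¬ KummerTimesUnique X T.covering) :=
  kummerTimesUnique_dichotomy_mlfClosure (MLFClosure.padic p) l kd

end NonarchTriMuDatum

end Literature.IUT.HodgeArakelov
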